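import Summits.KontsevichZagierPeriods.KontsevichZagierPeriods.Theorems.HurwitzMicroSectorsNormalFormPrincipleQuadNormalForm

/-!
# `NormalFormPrinciple` (stmt-KontsevichZagierPeriods-3869), line `SketchIdeator1` —
# the leaf `stub_boxRigidity` in dimension one — every quadratic-pole term is a mixed normal form

Pure proof file (lead seat c3; `--supports` the crux). Registered sub-goal `nfD_quad`:
`[(a,b), (Ax + B)/((x−u)²+v²)^{n+1}]` is in mixed normal form for all `n` — induction on `n` by the
reduction moves `quad_highA_sub_pt_mem_relations`, `quad_highB_mem_relations` down to the simple pole,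
which is `nfD_quad_log + nfD_quad_ang`.

Sources: M. Kontsevich, D. Zagier, *Periods* (2001), §1.2 rules (1)–(3). No definitions are introduced.
-/

noncomputable section

open MeasureTheory Set Finset
open scoped Polynomial
open Literature.NumberTheory.Transcendental Literature.NumberTheory.Transcendental.KZ
open Literature.ModelTheory.ExponentialFields (IsSemialgebraic isSemialgebraic_univ)

namespace Summit.KontsevichZagierPeriods.HurwitzMicroSectors.NormalFormPrinciple.PiBox

namespace Dlog

variable {RA : ℝ → ℝ → ℝ → IntegralRep 1} {ZA : ℝ → IntegralRep 0} {RG : ℝ → ℝ → IntegralRep 1}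

/-- **Every quadratic-pole term `[(a,b), (Ax + B)/((x−u)²+v²)^{n+1}]` is in mixed normal form**
(induction on `n`: the reduction formulas `quad_highA_sub_pt_mem_relations`,
`quad_highB_mem_relations` down to `n = 0`, then the logarithmic and arctangent parts).
[cite: KontsevichZagier2001, §1.2 rules (1)–(3)] -/
theorem nfD_quad
    {RA : ℝ → ℝ → ℝ → IntegralRep 1} {ZA : ℝ → IntegralRep 0} {RG : ℝ → ℝ → IntegralRep 1}
    (hR : ∀ a b c, IsAlgebraic ℚ a → IsAlgebraic ℚ b → IsAlgebraic ℚ c → 0 < a →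
      (RA a b c).domain = {x | x 0 ∈ Set.Ioo a b} ∧ (RA a b c).integrand = fun x => c / x 0)
    (hZ : ∀ r, IsAlgebraic ℚ r → (ZA r).domain = univ ∧ (ZA r).integrand = fun _ => r)
    (hRG : ∀ t d, IsAlgebraic ℚ t → IsAlgebraic ℚ d →
      (RG t d).domain = {x | x 0 ∈ Set.Ioo 0 t} ∧ (RG t d).integrand = fun x => d / (1 + x 0 ^ 2))
    {a b u v : ℝ} (ha : IsAlgebraic ℚ a) (hb : IsAlgebraic ℚ b) (hu : IsAlgebraic ℚ u)
    (hv : IsAlgebraic ℚ v) (hv0 : 0 < v) (hab : a ≤ b) :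
    ∀ (n : ℕ) (A B : ℝ) (N : IntegralRep 1), IsAlgebraic ℚ A → IsAlgebraic ℚ B →
      N.domain = {x | x 0 ∈ Set.Ioo a b} →
      EqOn N.integrand (fun x => (A * x 0 + B) / ((x 0 - u) ^ 2 + v ^ 2) ^ (n + 1)) N.domain →
      ∃ (r : ℝ) (k : ℕ) (u c : Fin k → ℝ) (k' : ℕ) (t d : Fin k' → ℝ), IsAlgebraic ℚ r ∧ (∀ j, 1 < u j) ∧
        (∀ j, IsAlgebraic ℚ (u j)) ∧ (∀ j, IsAlgebraic ℚ (c j)) ∧ (∀ l, 0 ≤ t l) ∧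
        (∀ l, IsAlgebraic ℚ (t l)) ∧ (∀ l, IsAlgebraic ℚ (d l)) ∧
        QuotientAddGroup.mk' relations (of N) = QuotientAddGroup.mk' relations (of (ZA r)) +
          ∑ j, QuotientAddGroup.mk' relations (of (RA 1 (u j) (c j))) +
          ∑ l, QuotientAddGroup.mk' relations (of (RG (t l) (d l))) := by
  have hv0' := hv0.ne'
  intro n
  induction n with
  | zero =>
    intro A B N hA hB hNd hNi
    have hB' : IsAlgebraic ℚ (B + A * u) := hB.add (hA.mul hu)
    obtain ⟨N₁, hN₁d, hN₁i⟩ := exists_quadRep (B := 0) ha hb hA isAlgebraic_zero hu hv hv0' 1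
    obtain ⟨N₂, hN₂d, hN₂i⟩ := exists_quadRep (A := 0) ha hb isAlgebraic_zero hB' hu hv hv0' 1
    have hN₁i' : EqOn N₁.integrand (fun x => A * (x 0 - u) / ((x 0 - u) ^ 2 + v ^ 2)) N₁.domain := by
      intro x _; rw [hN₁i]; simp only [add_zero, pow_one]
    have hN₂i' : EqOn N₂.integrand (fun x => (B + A * u) / ((x 0 - u) ^ 2 + v ^ 2)) N₂.domain := by
      intro x _; rw [hN₂i]; simp only [zero_mul, zero_add, pow_one]
    have hadd : of N - of N₁ - of N₂ ∈ relations := by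
      refine integrandAddRel_subset_relations ⟨1, N, N₁, N₂, by rw [hN₁d, hNd], by rw [hN₂d, hNd],
        fun x hx => ?_, rfl⟩
      rw [Pi.add_apply, hNi hx, hN₁i' (by rw [hN₁d, ← hNd]; exact hx),
        hN₂i' (by rw [hN₂d, ← hNd]; exact hx)]
      have hQ := (quad_pos (u := u) hv0' (x 0)).ne'
      simp only [zero_add, pow_one]
      field_simp
      ring
    rw [← QuotientAddGroup.eq_zero_iff] at hadd
    change QuotientAddGroup.mk' relations _ = 0 at hadd
    rw [map_sub, map_sub, sub_sub, sub_eq_zero] at hadd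
    rw [hadd]
    exact nfD_add hZ (nfD_quad_log hR hZ ha hb hA hu hv hv0 hab N₁ hN₁d hN₁i')
      (nfD_quad_ang hZ hRG ha hb hB' hu hv hv0 hab N₂ hN₂d hN₂i')
  | succ n ih =>
    intro A B N hA hB hNd hNi
    have hB' : IsAlgebraic ℚ (B + A * u) := hB.add (hA.mul hu)
    obtain ⟨N₁, hN₁d, hN₁i⟩ := exists_quadRep (B := 0) ha hb hA isAlgebraic_zero hu hv hv0' (n + 2)
    obtain ⟨N₂, hN₂d, hN₂i⟩ := exists_quadRep (A := 0) ha hb isAlgebraic_zero hB' hu hv hv0' (n + 2)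
    have hN₁i' : EqOn N₁.integrand (fun x => A * (x 0 - u) / ((x 0 - u) ^ 2 + v ^ 2) ^ (n + 2))
        N₁.domain := by
      intro x _; rw [hN₁i]; simp only [add_zero]
    have hN₂i' : EqOn N₂.integrand (fun x => (B + A * u) / ((x 0 - u) ^ 2 + v ^ 2) ^ (n + 2))
        N₂.domain := by
      intro x _; rw [hN₂i]; simp only [zero_mul, zero_add]
    have hadd : of N - of N₁ - of N₂ ∈ relations := by
      refine integrandAddRel_subset_relations ⟨1, N, N₁, N₂, by rw [hN₁d, hNd], by rw [hN₂d, hNd],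
        fun x hx => ?_, rfl⟩
      rw [Pi.add_apply, hNi hx, hN₁i' (by rw [hN₁d, ← hNd]; exact hx),
        hN₂i' (by rw [hN₂d, ← hNd]; exact hx)]
      rw [show n + 1 + 1 = n + 2 from rfl, ← add_div]
      ring
    -- the odd part is a point
    have hn : (2 * ((n:ℝ) + 1)) ≠ 0 := by positivity
    have hn1 : IsAlgebraic ℚ ((n:ℝ) + 1) := (isAlgebraic_nat (R := ℚ) n).add isAlgebraic_one
    set α₁ : ℝ := -A / (2 * ((n:ℝ) + 1)) with hα₁
    have hα₁A : IsAlgebraic ℚ α₁ := by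
      rw [hα₁, div_eq_mul_inv]; exact hA.neg.mul (isAlgebraic_two.mul hn1).inv
    have e₁ : -(2 * ((n:ℝ) + 1) * α₁) = A := by rw [hα₁, mul_div_cancel₀ _ hn, neg_neg]
    set r₁ : ℝ := α₁ / ((b - u) ^ 2 + v ^ 2) ^ (n + 1) - α₁ / ((a - u) ^ 2 + v ^ 2) ^ (n + 1) with hr₁
    have hr₁A : IsAlgebraic ℚ r₁ := by
      rw [hr₁, div_eq_mul_inv, div_eq_mul_inv]
      exact (hα₁A.mul ((((hb.sub hu).pow 2).add (hv.pow 2)).pow _).inv).sub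
        (hα₁A.mul ((((ha.sub hu).pow 2).add (hv.pow 2)).pow _).inv)
    have h1 : of N₁ - of (ZA r₁) ∈ relations :=
      quad_highA_sub_pt_mem_relations ha hb hα₁A hu hv hv0' hab n N₁ hN₁d
        (fun x hx => by rw [hN₁i' hx, e₁]) (ZA r₁) (hZ r₁ hr₁A).1 (hZ r₁ hr₁A).2
    -- the even part reduces
    have hv2 : (2 * ((n:ℝ) + 1) * v ^ 2) ≠ 0 := mul_ne_zero hn (pow_ne_zero 2 hv0')
    set α₂ : ℝ := (B + A * u) / (2 * ((n:ℝ) + 1) * v ^ 2) with hα₂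
    have hα₂A : IsAlgebraic ℚ α₂ := by
      rw [hα₂, div_eq_mul_inv]; exact hB'.mul ((isAlgebraic_two.mul hn1).mul (hv.pow 2)).inv
    have e₂ : 2 * ((n:ℝ) + 1) * v ^ 2 * α₂ = B + A * u := by rw [hα₂, mul_div_cancel₀ _ hv2]
    set r₂ : ℝ := α₂ * (b - u) / ((b - u) ^ 2 + v ^ 2) ^ (n + 1) -
      α₂ * (a - u) / ((a - u) ^ 2 + v ^ 2) ^ (n + 1) with hr₂
    have hr₂A : IsAlgebraic ℚ r₂ := by
      rw [hr₂, mul_div_assoc, mul_div_assoc, div_eq_mul_inv, div_eq_mul_inv]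
      exact (hα₂A.mul ((hb.sub hu).mul ((((hb.sub hu).pow 2).add (hv.pow 2)).pow _).inv)).sub
        (hα₂A.mul ((ha.sub hu).mul ((((ha.sub hu).pow 2).add (hv.pow 2)).pow _).inv))
    have hc'A : IsAlgebraic ℚ ((2 * (n:ℝ) + 1) * α₂) :=
      ((isAlgebraic_two.mul (isAlgebraic_nat (R := ℚ) n)).add isAlgebraic_one).mul hα₂A
    obtain ⟨N', hN'd, hN'i⟩ := exists_quadRep (A := 0) (B := (2 * (n:ℝ) + 1) * α₂) ha hb
      isAlgebraic_zero hc'A hu hv hv0' (n + 1)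
    have hN'i' : EqOn N'.integrand (fun x => ((2 * (n:ℝ) + 1) * α₂) / ((x 0 - u) ^ 2 + v ^ 2) ^ (n + 1))
        N'.domain := by
      intro x _; rw [hN'i]; simp only [zero_mul, zero_add]
    have h2 : of N₂ - of (ZA r₂) - of N' ∈ relations :=
      quad_highB_mem_relations ha hb hα₂A hu hv hv0' hab n N₂ hN₂d
        (fun x hx => by rw [hN₂i' hx, e₂]) (ZA r₂) (hZ r₂ hr₂A).1 (hZ r₂ hr₂A).2 N' hN'd hN'i'
    -- assemble
    have hN' := ih 0 ((2 * (n:ℝ) + 1) * α₂) N' isAlgebraic_zero hc'A hN'd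
      (fun x hx => by simp only [hN'i' hx, zero_mul, zero_add])
    have hclass : QuotientAddGroup.mk' relations (of N) =
        QuotientAddGroup.mk' relations (of (ZA r₁)) + (QuotientAddGroup.mk' relations (of (ZA r₂)) +
          QuotientAddGroup.mk' relations (of N')) := by
      rw [← QuotientAddGroup.eq_zero_iff] at hadd h1 h2
      change QuotientAddGroup.mk' relations _ = 0 at hadd h1 h2
      rw [map_sub, map_sub, sub_sub, sub_eq_zero] at hadd h2
      rw [map_sub, sub_eq_zero] at h1
      rw [hadd, h1, h2]
    rw [hclass]
    exact nfD_add hZ (nfD_pt hZ hr₁A (ZA r₁) (hZ r₁ hr₁A).1 (hZ r₁ hr₁A).2)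
      (nfD_add hZ (nfD_pt hZ hr₂A (ZA r₂) (hZ r₂ hr₂A).1 (hZ r₂ hr₂A).2) hN')

end Dlog

end Summit.KontsevichZagierPeriods.HurwitzMicroSectors.NormalFormPrinciple.PiBox
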